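import Summits.HubbardSuperconductivity.HubbardSuperconductivity.Theorems.AnisotropyChordKnnAll
import Summits.HubbardSuperconductivity.HubbardSuperconductivity.Theorems.AnisotropyChordKnnIntervalFull32

/-!
# Route `AnisotropyChord` / H0 rotor rung, K_{n,n} sibling of XY-LM₀: the decided family in ONE statement —
# `XYLiebMattisKnn n Δ` for `n ≤ 32` on the whole interval `−4/5 ≤ Δ ≤ 1`
(prover seat `hubbard-h0-rotor-p1` g16; glue of g13's interval tables `…KnnIntervalFull32` (`Δ ∈ [−4/5, 63/64]`) with the
all-`n` THEOREM Q⁺ `…KnnAll` (`Δ ∈ [0, 1]`), which closes the former corner `(63/64, 1)`)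
-/

set_option linter.dupNamespace false
set_option autoImplicit false

namespace Summit.HubbardSuperconductivity.HubbardSuperconductivity.Theorems.AnisotropyChord.Knn

/-- **`XYLiebMattisKnn n Δ` for every `n ≤ 32` and every `−4/5 ≤ Δ ≤ 1`** (the theory seat's booked family «K_{n,n},
s ≤ 16, Δ_t ∈ [−0.8, 1]» with no corner left open).  For `Δ ≥ 0` this holds for every `n` (`xyLiebMattisKnn_all`).
[conjecture: theory seat hubbard-h0-rotor-theory-1, cycle 12 — THEOREM Q⁺ decided family; Lean proof here] -/
theorem xyLiebMattisKnn_of_le_32 {n : ℕ} (hn : n ≤ 32) {Δ : ℝ} (h0 : -(4 / 5 : ℝ) ≤ Δ) (h1 : Δ ≤ 1) :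
    XYLiebMattisKnn n Δ := by
  by_cases h : 0 ≤ Δ
  · exact xyLiebMattisKnn_all n h h1
  · exact xyLiebMattisKnn_full_of_le_32 hn h0 (by linarith)

end Summit.HubbardSuperconductivity.HubbardSuperconductivity.Theorems.AnisotropyChord.Knn
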